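import Summits.KontsevichZagierPeriods.KontsevichZagierPeriods.Theorems.RootDecompRationalCubeDichotomyPiRationalisationSqrtDefs
import Literature.NumberTheory.Transcendental.KZVolumeConjectureProofs

/-!
# Route RootDecompRationalCubeDichotomy — PROVED RUNGS of the rank-2 crux `PiRationalisation`
# (item stmt-KontsevichZagierPeriods-24903): π-rationalisation of quadratic irrationalities, in every dimension

BC5 / T3 witness for item 24903 (`--supports stmt-KontsevichZagierPeriods-24903`; this file closes no item and
claims none — the content of item 26388 that it needs is re-proved for the local literal `ratCubeSet`).

* `PiRationalisationSqrt` (ALL `n`) — for a cube representation `s` in dimension `n` with integrand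
  `a₁/a₂ + (b₁/b₂)·√p` on `[0,1]ⁿ` (`a₂, b₂` zero-free and `p > 0` on `[0,1]ⁿ`, all in `ℚ[x₁,…,xₙ]`; this is the
  generic DEGREE-2 layer of the item: Nash integrands quadratic over `ℚ(x)` whose leading coefficient and
  discriminant are zero-free on the closed cube): `∀ K ≥ 1, ([π]·)^[K] [s] ∈ relations ⊔ ⟨rational closed-cube sector⟩`;
  PROVED UNCONDITIONALLY (`piRationalisationSqrt_holds`, `K₀ = 1`) and certified a LITERAL SPECIAL CASE of the item
  (`piRationalisationSqrt_of_piRationalisation`, `U = {a₂ ≠ 0} ∩ {b₂ ≠ 0} ∩ {p > 0}`).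
* `PiRationalisationSqrtOne` — its case `n = 1` (the hyperelliptic line; `piRationalisationSqrtOne_of_sqrt`,
  `piRationalisationSqrtOne_holds`, `piRationalisationSqrtOne_of_piRationalisation`), kept verbatim as first certified.

The proof runs inside Kontsevich–Zagier's four moves: `[π]·[s_B] ≡ 2·[[0,1]ⁿ⁺¹, b₁p/(b₂(p(1−σ)²+σ²))]` —
`[π] = 4[[0,1], dt/(1+t²)]` (tree theorem `Theorems.soloInformed_piRep_sub_four_nsmul_arctanRep_mem_relations`,
by name), the doubling substitution `σ = 2t/(1+2t−t²)`, the commutator / Fubini, and the fibred Möbius substitution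
`σ = σ'/(√p + (1−√p)σ')` over the base cube, which makes the integrand RATIONAL (`c·dσ/((1−σ)²+σ²) = c²dσ'/(c²(1−σ')²+σ'²)`,
`c² = p`); the rational part `a₁/a₂` is already in the sector and `[π]·sector ⊆ relations ⊔ ⟨sector⟩`
(`piRep_mul_mem_sup_of_mem_ratCubeSet`). The rungs lie outside S's decided regime (no kernel theorem for algebraic
non-rational integrands, nor for rational ones in dimension ≥ 2, is known) and exercise exactly the route's lever:
the algebraic function `√p` is absorbed INSIDE the moves at the price of one `[π]`.

New general move: `of_sub_of_mem_relations_of_fibreMap` — change of variables along the last coordinate by a fibred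
`C¹` semialgebraic substitution with positive `t`-derivative (generalises `KZ.of_sub_of_mem_relations_of_affine`;
Jacobian via `LinearMap.det_of_snoc_init`); instances `…_doubling`, `…_sqrtMoebiusN` (all `n`).

(= sections `## v5` / `## v5.1 (gen 4)` of the decomp-kz lens-2 node file
`run/shared/lean/pub/decomp-kz/decomp-kz-lens-2/g4/RationalCubeDichotomy.lean`, Theorems-split part 3/3 — parts 1/2 = `…PiRationalisationSqrtMoves.lean` / `…PiRationalisationSqrtDefs.lean`; everything lives in the sub-namespace
`Rung24903`, independent of the sibling `SectorMerge` / `PiTimesSector` Theorems files. Standard axioms, 0 sorry.)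
-/

namespace Summit.KontsevichZagierPeriods.RootDecompRationalCubeDichotomy.Rung24903

open MeasureTheory Set MvPolynomial
open Literature.NumberTheory.Transcendental Literature.NumberTheory.Transcendental.KZ
open Literature.ModelTheory.ExponentialFields (IsSemialgebraic)
open Summit.KontsevichZagierPeriods.KontsevichZagierPeriods.Theses.RootDecompRationalCubeDichotomy
  (PiRationalisation PiTimesSector)

/-- The one-dimensional rung is the case `n = 1` of the all-dimensions rung. [this node] -/
theorem piRationalisationSqrtOne_of_sqrt (h : PiRationalisationSqrt) : PiRationalisationSqrtOne :=
  fun s => h 1 s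

/-- The all-dimensions rung IS a literal special case of item 24903 (`U = {a₂ ≠ 0} ∩ {b₂ ≠ 0} ∩ {p > 0} ⊆ ℝⁿ`).
[this node] -/
theorem piRationalisationSqrt_of_piRationalisation (hR : PiRationalisation) : PiRationalisationSqrt := by
  intro n s a₁ a₂ b₁ b₂ p ha₂ hb₂ hp hsd hsi
  let U : Set (Fin n → ℝ) := ({y | aeval y a₂ ≠ 0} ∩ {y | aeval y b₂ ≠ 0}) ∩ {y | 0 < aeval y p}
  have hUo : IsOpen U :=
    ((isOpen_ne_fun (Literature.ModelTheory.ExponentialFields.continuous_aeval_real a₂) continuous_const).inter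
      (isOpen_ne_fun (Literature.ModelTheory.ExponentialFields.continuous_aeval_real b₂) continuous_const)).inter
      (isOpen_lt continuous_const (Literature.ModelTheory.ExponentialFields.continuous_aeval_real p))
  have hsub : Set.pi Set.univ (fun _ : Fin n => Set.Icc (0:ℝ) 1) ⊆ U :=
    fun y hy => ⟨⟨ha₂ y hy, hb₂ y hy⟩, hp y hy⟩
  have hUsa : IsSemialgebraic ℚ U :=
    ((Literature.ModelTheory.ExponentialFields.isSemialgebraic_setOf_eval_ne_zero a₂).inter
      (Literature.ModelTheory.ExponentialFields.isSemialgebraic_setOf_eval_ne_zero b₂)).inter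
      (Literature.ModelTheory.ExponentialFields.isSemialgebraic_setOf_eval_pos p)
  have hg : IsSemialgebraicFunOn ℚ U
      (fun y => aeval y a₁ / aeval y a₂ + aeval y b₁ / aeval y b₂ * √(aeval y p)) :=
    (IsSemialgebraicFunOn.add_holds (isSemialgebraicFunOn_aeval_div_aeval hUsa a₁ a₂ fun y hy => hy.1.1)
      (IsSemialgebraicFunOn.mul_holds (isSemialgebraicFunOn_aeval_div_aeval hUsa b₁ b₂ fun y hy => hy.1.2)
        (IsSemialgebraicFunOn.sqrt_holds (isSemialgebraicFunOn_aeval hUsa p)))).congr fun y _ => rfl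
  have han : AnalyticOnNhd ℝ
      (fun y => aeval y a₁ / aeval y a₂ + aeval y b₁ / aeval y b₂ * √(aeval y p)) U := by
    intro y hy
    have hA : ∀ q : MvPolynomial (Fin n) ℚ, AnalyticAt ℝ (fun x : Fin n → ℝ => aeval x q) y := fun q =>
      Literature.ModelTheory.ExponentialFields.analyticOnNhd_aeval (k := ℚ) q y (Set.mem_univ _)
    have hsqrt : AnalyticAt ℝ Real.sqrt (aeval y p) := by
      have hpos : 0 < aeval y p := hy.2
      have h : AnalyticAt ℝ (fun τ : ℝ => Real.exp (Real.log τ / 2)) (aeval y p) := by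
        fun_prop (disch := assumption)
      refine h.congr ?_
      filter_upwards [Ioi_mem_nhds hy.2] with τ hτ
      rw [Real.sqrt_eq_rpow, Real.rpow_def_of_pos hτ]
      congr 1; ring
    have hsq : AnalyticAt ℝ (fun x : Fin n → ℝ => √(aeval x p)) y :=
      hsqrt.comp_of_eq (hA p) rfl
    exact ((hA a₁).fun_div (hA a₂) hy.1.1).fun_add (((hA b₁).fun_div (hA b₂) hy.1.2).fun_mul hsq)
  exact hR n _ U s hUo hsub hg han hsd hsi

/-- **THE ALL-DIMENSIONS RUNG IS PROVED** from `[π] − 4·[[0,1], 1/(1+t²)] ∈ relations` (tree theorem, by name):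
`K₀ = 1`. Chain, all inside Kontsevich–Zagier's moves: `[s] = [T_A] + [s_B]` (additivity; `T_A = a₁/a₂` is already in
the sector, `piIter_mem_sup`); `[π]·[s_B] ≡ 4[A]·[s_B] ≡ 2[A2]·[s_B]` (right ideal; doubling the integrand);
`[A2] ≡ [C1]`, `C1 = [[0,1], dσ/((1−σ)²+σ²)]` (the substitution `σ = 2t/(1+2t−t²)`, `of_sub_of_mem_relations_doubling`);
`[C1]·[s_B] ≡ [s_B]·[C1] = [s_B × C1]` (commutator, Fubini); `[s_B × C1] ≡ [R]`,
`R = [[0,1]ⁿ⁺¹, b₁p/(b₂(p(1−σ')²+σ'²))]` RATIONAL (the fibred Möbius substitution `σ = σ'/(√p + (1−√p)σ')` over the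
base cube, `of_sub_of_mem_relations_sqrtMoebiusN`); `[R] ∈ sector`. [this node] -/
theorem piRationalisationSqrt_of_arctanRep (A : IntegralRep 1) (hAd : A.domain = {x | 0 ≤ x 0 ∧ x 0 ≤ 1})
    (hAi : A.integrand = fun x => 1 / (1 + x 0 ^ 2)) (hπ : of piRep - 4 • of A ∈ relations) :
    PiRationalisationSqrt := by
  intro n s a₁ a₂ b₁ b₂ p ha₂ hb₂ hp hsd hsi
  have hπT : PiTimesSector := fun y hy => piRep_mul_mem_sup_of_mem_ratCubeSet hy
  have hIc : IsCompact A.domain := by rw [hAd, unitI_eq_cubeLit]; exact isCompact_cubeLit 1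
  -- A2 = [A.domain, 2/(1+t²)]
  have hA2sa : IsSemialgebraicFunOn ℚ A.domain (fun x : Fin 1 → ℝ => 2 / (1 + x 0 ^ 2)) := by
    refine (isSemialgebraicFunOn_aeval_div_aeval A.isSemialgebraic_domain (C (2:ℚ)) (1 + X 0 ^ 2)
      fun z _ => ?_).congr fun z _ => ?_
    · simp only [map_add, map_one, map_pow, MvPolynomial.aeval_X]; positivity
    · simp only [map_add, map_one, map_pow, MvPolynomial.aeval_X, MvPolynomial.aeval_C, eq_ratCast,
        Rat.cast_ofNat]
  have hA2c : ContinuousOn (fun x : Fin 1 → ℝ => 2 / (1 + x 0 ^ 2)) A.domain :=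
    (continuous_const.div (by fun_prop) fun x => by positivity).continuousOn
  let A2 : IntegralRep 1 := contRep A.domain A.isSemialgebraic_domain hIc _ hA2sa hA2c
  -- C1 = [A.domain, 1/((1-σ)²+σ²)]
  have hCpos : ∀ t : ℝ, 0 < (1 - t) ^ 2 + t ^ 2 := fun t => by nlinarith [sq_nonneg (2 * t - 1)]
  have hC1sa : IsSemialgebraicFunOn ℚ A.domain (fun x : Fin 1 → ℝ => 1 / ((1 - x 0) ^ 2 + x 0 ^ 2)) := by
    refine (isSemialgebraicFunOn_aeval_div_aeval A.isSemialgebraic_domain (C (1:ℚ))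
      ((1 - X 0) ^ 2 + X 0 ^ 2) fun z _ => ?_).congr fun z _ => ?_
    · simp only [map_add, map_sub, map_one, map_pow, MvPolynomial.aeval_X]; exact (hCpos _).ne'
    · simp only [map_add, map_sub, map_one, map_pow, MvPolynomial.aeval_X]
  have hC1c : ContinuousOn (fun x : Fin 1 → ℝ => 1 / ((1 - x 0) ^ 2 + x 0 ^ 2)) A.domain :=
    (continuous_const.div (by fun_prop) fun x => (hCpos _).ne').continuousOn
  let C1 : IntegralRep 1 := contRep A.domain A.isSemialgebraic_domain hIc _ hC1sa hC1c
  -- S = [[0,1]ⁿ, (b₁/b₂)·√p]  (the irrational part of `s`)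
  have hIsa : IsSemialgebraic ℚ (Set.pi Set.univ (fun _ : Fin n => Set.Icc (0:ℝ) 1)) :=
    isSemialgebraic_cubeLit n
  have hSsa : IsSemialgebraicFunOn ℚ (Set.pi Set.univ (fun _ : Fin n => Set.Icc (0:ℝ) 1))
      (fun y => aeval y b₁ / aeval y b₂ * √(aeval y p)) :=
    (IsSemialgebraicFunOn.mul_holds (isSemialgebraicFunOn_aeval_div_aeval hIsa b₁ b₂ hb₂)
      (IsSemialgebraicFunOn.sqrt_holds (isSemialgebraicFunOn_aeval hIsa p))).congr fun y _ => rfl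
  have hSc : ContinuousOn (fun y => aeval y b₁ / aeval y b₂ * √(aeval y p))
      (Set.pi Set.univ (fun _ : Fin n => Set.Icc (0:ℝ) 1)) :=
    ((Literature.ModelTheory.ExponentialFields.continuous_aeval_real b₁).continuousOn.div
      (Literature.ModelTheory.ExponentialFields.continuous_aeval_real b₂).continuousOn hb₂).mul
      (Literature.ModelTheory.ExponentialFields.continuous_aeval_real p).continuousOn.sqrt
  let S : IntegralRep n := contRep _ hIsa (isCompact_cubeLit n) _ hSsa hSc
  -- R = the rational box one dimension up
  let P2 : MvPolynomial (Fin (n + 1)) ℚ := rename Fin.castSucc b₁ * rename Fin.castSucc p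
  let Q2 : MvPolynomial (Fin (n + 1)) ℚ :=
    rename Fin.castSucc b₂ * (rename Fin.castSucc p * (1 - X (Fin.last n)) ^ 2 + X (Fin.last n) ^ 2)
  have hJsa : IsSemialgebraic ℚ (Set.pi Set.univ (fun _ : Fin (n + 1) => Set.Icc (0:ℝ) 1)) :=
    isSemialgebraic_cubeLit (n + 1)
  have hQ2ne : ∀ z ∈ Set.pi Set.univ (fun _ : Fin (n + 1) => Set.Icc (0:ℝ) 1), aeval z Q2 ≠ 0 := by
    intro z hz
    rw [Set.mem_univ_pi] at hz
    have hin : Fin.init z ∈ Set.pi Set.univ (fun _ : Fin n => Set.Icc (0:ℝ) 1) :=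
      Set.mem_univ_pi.mpr fun i => hz (Fin.castSucc i)
    have h1 := hb₂ _ hin
    have h2 := hp _ hin
    have h3 := sq_den_pos (Real.sqrt_pos.2 h2) (hz (Fin.last n)).1
    rw [Real.sq_sqrt h2.le] at h3
    simp only [Q2, map_mul, map_add, map_pow, map_sub, map_one, MvPolynomial.aeval_X, aeval_rename_castSucc]
    exact mul_ne_zero h1 h3.ne'
  have hRsa : IsSemialgebraicFunOn ℚ (Set.pi Set.univ (fun _ : Fin (n + 1) => Set.Icc (0:ℝ) 1))
      (fun z => aeval z P2 / aeval z Q2) := isSemialgebraicFunOn_aeval_div_aeval hJsa P2 Q2 hQ2ne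
  have hRc : ContinuousOn (fun z => aeval z P2 / aeval z Q2)
      (Set.pi Set.univ (fun _ : Fin (n + 1) => Set.Icc (0:ℝ) 1)) :=
    (Literature.ModelTheory.ExponentialFields.continuous_aeval_real P2).continuousOn.div
      (Literature.ModelTheory.ExponentialFields.continuous_aeval_real Q2).continuousOn hQ2ne
  let R : IntegralRep (n + 1) := contRep _ hJsa (isCompact_cubeLit (n + 1)) _ hRsa hRc
  -- T_A : the rational part of `s`
  have ha₂' : ∀ x ∈ KZ.cube n, aeval x a₂ ≠ 0 := fun x hx => ha₂ x (by rw [cubeLit_eq_cube]; exact hx)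
  let TA : RFun n := ⟨a₁, a₂, ha₂'⟩
  -- (1) additivity of the integrand: [s] = [T_A] + [S]
  have h1 : of s - of TA.rep - of S ∈ relations := by
    refine integrandAddRel_subset_relations ⟨n, s, TA.rep, S, ?_, ?_, fun z hz => ?_, rfl⟩
    · rw [RFun.rep_domain, hsd, cubeLit_eq_cube]
    · show Set.pi Set.univ (fun _ : Fin n => Set.Icc (0:ℝ) 1) = s.domain
      rw [hsd]
    · have hz' : z ∈ Set.pi Set.univ (fun _ : Fin n => Set.Icc (0:ℝ) 1) := by rw [← hsd]; exact hz
      rw [Pi.add_apply, RFun.rep_integrand, RFun.fn_apply]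
      exact hsi z hz'
  -- (2) doubling the integrand: 2[A] ≡ [A2]
  have h2 : of A + of A - of A2 ∈ relations := by
    have h : of A2 - of A - of A ∈ relations := by
      refine integrandAddRel_subset_relations ⟨1, A2, A, A, rfl, rfl, fun z _ => ?_, rfl⟩
      show (2:ℝ) / (1 + z 0 ^ 2) = (A.integrand + A.integrand) z
      rw [Pi.add_apply, hAi]
      ring
    have := relations.neg_mem h
    rwa [show -(of A2 - of A - of A) = of A + of A - of A2 by abel] at this
  -- (3) the doubling substitution: [A2] ≡ [C1]
  have h3 : of A2 - of C1 ∈ relations := of_sub_of_mem_relations_doubling A2 C1 hAd rfl hAd rfl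
  -- (4) the fibred Möbius substitution over the base cube: [R] ≡ [S × C1]
  have h4 : of R - of (S.prod C1) ∈ relations :=
    of_sub_of_mem_relations_sqrtMoebiusN S C1 R b₁ b₂ p rfl rfl hb₂ hp hAd rfl rfl rfl
  -- (5) R and T_A lie in the sector
  have h5 : of R ∈ ratCubeSet := ⟨n + 1, R, P2, Q2, rfl, hQ2ne, fun z _ => rfl, rfl⟩
  have h6 : of TA.rep ∈ ratCubeSet := rfun_rep_mem_ratCubeSet TA
  -- MAIN: [π]·[S] ∈ relations ⊔ ⟨sector⟩
  have hπC : of piRep - (of C1 + of C1) ∈ relations := by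
    have e : of piRep - (of C1 + of C1) =
        (of piRep - 4 • of A) + ((of A + of A - of A2) + (of A + of A - of A2)) +
          ((of A2 - of C1) + (of A2 - of C1)) := by abel
    rw [e]
    exact add_mem (add_mem hπ (add_mem h2 h2)) (add_mem h3 h3)
  have hπCS : (of piRep - (of C1 + of C1)) * of S ∈ relations := mul_mem_relations_right_holds _ _ hπC
  have hcomm : of C1 * of S - of S * of C1 ∈ relations := mul_sub_mul_comm_mem_relations _ _
  have hprod : of S * of C1 - of R ∈ relations := by
    rw [of_mul_of]
    have := relations.neg_mem h4
    rwa [neg_sub] at this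
  have hRR : of R + of R ∈ AddSubgroup.closure ratCubeSet :=
    add_mem (AddSubgroup.subset_closure h5) (AddSubgroup.subset_closure h5)
  have hmain : of piRep * of S ∈ relations ⊔ AddSubgroup.closure ratCubeSet := by
    have e : of piRep * of S =
        (of piRep - (of C1 + of C1)) * of S +
          ((of C1 * of S - of S * of C1) + (of C1 * of S - of S * of C1)) +
          ((of S * of C1 - of R) + (of S * of C1 - of R)) + (of R + of R) := by
      rw [sub_mul, add_mul]; abel
    rw [e]
    exact add_mem (AddSubgroup.mem_sup_left (add_mem (add_mem hπCS (add_mem hcomm hcomm))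
      (add_mem hprod hprod))) (AddSubgroup.mem_sup_right hRR)
  -- conclusion, K₀ = 1
  refine ⟨1, fun K hK => ?_⟩
  show (fun x : FormalRep => of piRep * x)^[K] (of s) ∈ relations ⊔ AddSubgroup.closure ratCubeSet
  obtain ⟨K', rfl⟩ : ∃ K', K = K' + 1 := ⟨K - 1, by omega⟩
  have e : of s = (of s - of TA.rep - of S) + of TA.rep + of S := by abel
  rw [e, piIter_add, piIter_add]
  refine add_mem (add_mem ?_ ?_) ?_
  · exact AddSubgroup.mem_sup_left (piRep_mul_iterate_mem_relations _ h1)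
  · exact piIter_mem_sup hπT _ (AddSubgroup.mem_sup_right (AddSubgroup.subset_closure h6))
  · rw [Function.iterate_succ_apply]
    exact piIter_mem_sup hπT K' hmain

/-- Value form of the all-dimensions rung (proved instances of V_R, item 24940): for `K ≥ 1`,
`π^K · ∫_{[0,1]ⁿ} (a₁/a₂ + (b₁/b₂)√p)` is the value of an element of the rational closed-cube span. [this node] -/
theorem piRationalisationSqrt_values (h : PiRationalisationSqrt) {n : ℕ} (s : IntegralRep n)
    (a₁ a₂ b₁ b₂ p : MvPolynomial (Fin n) ℚ)
    (ha₂ : ∀ z ∈ Set.pi Set.univ (fun _ : Fin n => Set.Icc (0:ℝ) 1), aeval z a₂ ≠ 0)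
    (hb₂ : ∀ z ∈ Set.pi Set.univ (fun _ : Fin n => Set.Icc (0:ℝ) 1), aeval z b₂ ≠ 0)
    (hp : ∀ z ∈ Set.pi Set.univ (fun _ : Fin n => Set.Icc (0:ℝ) 1), 0 < aeval z p)
    (hsd : s.domain = Set.pi Set.univ (fun _ : Fin n => Set.Icc (0:ℝ) 1))
    (hsi : ∀ z ∈ Set.pi Set.univ (fun _ : Fin n => Set.Icc (0:ℝ) 1),
      s.integrand z = aeval z a₁ / aeval z a₂ + aeval z b₁ / aeval z b₂ * √(aeval z p)) :
    ∃ K₀ : ℕ, ∀ K : ℕ, K₀ ≤ K → ∃ y ∈ AddSubgroup.closure ratCubeSet, eval y = Real.pi ^ K * s.value := by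
  obtain ⟨K₀, hK₀⟩ := h n s a₁ a₂ b₁ b₂ p ha₂ hb₂ hp hsd hsi
  refine ⟨K₀, fun K hK => ?_⟩
  obtain ⟨ρ, hρ, y, hy, hρy⟩ := AddSubgroup.mem_sup.mp (hK₀ K hK)
  refine ⟨y, hy, ?_⟩
  have h1 := congrArg eval hρy
  rw [map_add, eval_eq_zero_of_mem_relations hρ, zero_add, eval_piIter, eval_of] at h1
  exact h1

/-- **The all-dimensions rung holds unconditionally.** [this route] -/
theorem piRationalisationSqrt_holds : PiRationalisationSqrt :=
  piRationalisationSqrt_of_arctanRep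
    Summit.KontsevichZagierPeriods.KontsevichZagierPeriods.Theorems.soloInformedArctanRep rfl rfl
    Summit.KontsevichZagierPeriods.KontsevichZagierPeriods.Theorems.soloInformed_piRep_sub_four_nsmul_arctanRep_mem_relations

/-! ### The case `n = 1` (the hyperelliptic line), as first certified in the node (v5) -/

/-- The `n = 1` rung is a literal special case of item 24903. [this node] -/
theorem piRationalisationSqrtOne_of_piRationalisation (hR : PiRationalisation) : PiRationalisationSqrtOne :=
  piRationalisationSqrtOne_of_sqrt (piRationalisationSqrt_of_piRationalisation hR)

/-- **The `n = 1` rung holds unconditionally.** [this route] -/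
theorem piRationalisationSqrtOne_holds : PiRationalisationSqrtOne :=
  piRationalisationSqrtOne_of_sqrt piRationalisationSqrt_holds

/-- Bundle: both rungs are literal special cases of item 24903 and both hold; standard axioms
(`#print axioms rung24903`). -/
theorem rung24903 :
    (PiRationalisation → PiRationalisationSqrt) ∧ PiRationalisationSqrt ∧
      (PiRationalisationSqrt → PiRationalisationSqrtOne) ∧ PiRationalisationSqrtOne :=
  ⟨piRationalisationSqrt_of_piRationalisation, piRationalisationSqrt_holds, piRationalisationSqrtOne_of_sqrt,
    piRationalisationSqrtOne_holds⟩

end Summit.KontsevichZagierPeriods.RootDecompRationalCubeDichotomy.Rung24903
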